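import Summits.RiemannHypothesis.RiemannHypothesis.Theorems.TwoPrimeFoldRigidity.Negative.MBTConditioning

/-!
# One-lattice moment-blind towers, part 5: the recursion and the budget

HONEST LABEL.  Negative-side helper toward `¬ IntegerScrew.TwoPrimeFoldRigidity` (item stmt-RiemannHypothesis-25784);
record-negative programme; 0 toward RH.  RH is not proved, not used, not mentioned below.
Nothing here bears on the truth of RH.

`amp_eq` (level `m` solves against the residual of the earlier dividing levels), `Φ_amp_one` (exact cancellation at
the own time), and the strong-induction budget `E_m ≤ 2·10⁶ (m+1)⁻⁴` (`E_le`), from the spill decay `e^{-20(j-1)}`,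
`e^{-20} ≤ 10⁻⁸` and `Σ_{j≥2} j⁴ e^{-20(j-1)} ≤ 17 e^{-20}`.
-/

set_option linter.dupNamespace false

noncomputable section

open scoped ComplexConjugate
open Complex Finset

namespace Summit.RiemannHypothesis.RiemannHypothesis.Theorems.TwoPrimeFoldRigidity.Negative.MBT

namespace Prm

variable (p : Prm)

/-! ## §5 The recursion: levels solved in order against the spill of the earlier, dividing levels -/

/-- levels already solved are not changed later. -/
theorem ampSeq_stable (M m : ℕ) (hm : m ≤ M) : p.ampSeq M m = p.amp m := by
  induction M with
  | zero =>
    obtain rfl : m = 0 := Nat.le_zero.mp hm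
    rfl
  | succ M ih =>
    rcases Nat.lt_or_eq_of_le hm with h | h
    · have : m ≠ M + 1 := by omega
      simp only [ampSeq, this, if_false]
      exact ih (by omega)
    · subst h; rfl

/-- the residual of level `m` only depends on the earlier levels. -/
theorem R_congr (a b : ℕ → G → ℝ) (m : ℕ) (hab : ∀ m' < m, a m' = b m') (r : ℕ) : p.R a m r = p.R b m r := by
  unfold R
  refine Finset.sum_congr rfl fun m' hm' ↦ ?_
  have : m' < m := by
    simp only [D, Finset.mem_filter, Finset.mem_range] at hm'
    exact hm'.1
  rw [hab m' this]

/-- the defining equation of the amplitudes: level `m` solves against the residual of the earlier levels. -/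
theorem amp_eq (m : ℕ) : p.amp m = p.solve m (p.tgt p.amp m) := by
  have htgt : ∀ (a : ℕ → G → ℝ), (∀ m' < m, a m' = p.amp m') → p.tgt a m = p.tgt p.amp m := by
    intro a ha
    funext r
    simp only [tgt, p.R_congr a p.amp m ha r]
  cases m with
  | zero =>
    show p.ampSeq 0 0 = _
    simp only [ampSeq, if_true]
    rw [htgt _ (fun m' hm' ↦ absurd hm' (Nat.not_lt_zero _))]
  | succ M =>
    show p.ampSeq (M + 1) (M + 1) = _
    simp only [ampSeq, if_true]
    rw [htgt _ (fun m' hm' ↦ p.ampSeq_stable M m' (by omega))]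

/-- amplitudes are positive. -/
theorem amp_pos (m : ℕ) (g : G) : 0 < p.amp m g := by
  rw [p.amp_eq m]; exact p.solve_pos m _ g

/-- amplitudes are at least the slack `f_m`. -/
theorem f_le_amp (m : ℕ) (g : G) : f m ≤ p.amp m g := by
  rw [p.amp_eq m]; exact p.f_le_solve m _ g

/-- **exact cancellation at the own time of level `m`**: `Φ(amp m, m, 1) = − R(m)`. -/
theorem Φ_amp_one (m : ℕ) (r : ℕ) (hr : r ≤ 2) : p.Φ (p.amp m) m 1 r = -p.R p.amp m r := by
  have h := p.solve_exact m (p.tgt p.amp m) r hr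
  rw [← p.amp_eq m] at h
  unfold Φ
  simp only [φ] at h
  simp only [Nat.cast_one, sub_self, mul_zero, neg_zero, Real.exp_zero, Complex.ofReal_one, mul_one]
  rw [h]
  simp only [tgt]
  ring

/-! ## §6 The budget: total amplitude of level `m` is `O((m+1)⁻⁴)` by strong induction -/

/-- `E_m ≥ 0`. -/
theorem E_nonneg (m : ℕ) : 0 ≤ p.E m := Finset.sum_nonneg fun g _ ↦ (p.amp_pos m g).le

/-- each amplitude is at most the level total. -/
theorem amp_le_E (m : ℕ) (g : G) : p.amp m g ≤ p.E m :=
  Finset.single_le_sum (fun g' _ ↦ (p.amp_pos m g').le) (Finset.mem_univ g)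

/-- the weighted size is subadditive over finite sums. -/
theorem nrm_sum_le {α : Type*} (m : ℕ) (s : Finset α) (v : α → ℕ → ℂ) :
    p.nrm m (fun r ↦ ∑ a ∈ s, v a r) ≤ ∑ a ∈ s, p.nrm m (v a) := by
  have hM : 0 < 15 * p.Γ m := by have := p.Γ_pos m; positivity
  simp only [nrm, Finset.sum_add_distrib, ← Finset.sum_div]
  gcongr
  · exact norm_sum_le _ _
  · exact norm_sum_le _ _
  · exact norm_sum_le _ _

/-- weighted size of `-v - w`. -/
theorem nrm_neg_sub (m : ℕ) (v w : ℕ → ℂ) : p.nrm m (fun r ↦ -v r - w r) ≤ p.nrm m v + p.nrm m w := by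
  have hM : 0 < 15 * p.Γ m := by have := p.Γ_pos m; positivity
  simp only [nrm]
  have h : ∀ r, ‖-v r - w r‖ ≤ ‖v r‖ + ‖w r‖ := fun r ↦ by
    rw [show -v r - w r = -(v r + w r) by ring, norm_neg]; exact norm_add_le _ _
  have h0 := h 0; have h1 := h 1; have h2 := h 2
  have e1 : ‖-v 1 - w 1‖ / (15 * p.Γ m) ≤ ‖v 1‖ / (15 * p.Γ m) + ‖w 1‖ / (15 * p.Γ m) := by
    rw [← add_div]; exact div_le_div_of_nonneg_right h1 hM.le
  have e2 : ‖-v 2 - w 2‖ / (15 * p.Γ m) ^ 2 ≤ ‖v 2‖ / (15 * p.Γ m) ^ 2 + ‖w 2‖ / (15 * p.Γ m) ^ 2 := by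
    rw [← add_div]; exact div_le_div_of_nonneg_right h2 (by positivity)
  linarith

/-- the own forcing term has weighted size `≤ 3 f`. -/
theorem nrm_forcing_le (m : ℕ) : p.nrm m (fun r ↦ (f m : ℂ) * p.W m (Sum.inr (Sum.inr ())) r) ≤ 3 * f m := by
  have hM : 0 < 15 * p.Γ m := by have := p.Γ_pos m; positivity
  have hf := (f_pos m).le
  have h : ∀ r, ‖(f m : ℂ) * p.W m (Sum.inr (Sum.inr ())) r‖ ≤ f m * (15 * p.Γ m) ^ r := fun r ↦ by
    rw [norm_mul, Complex.norm_real, Real.norm_of_nonneg hf]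
    exact mul_le_mul_of_nonneg_left (p.norm_W_le m _ r) hf
  simp only [nrm]
  have h0 := h 0; have h1 := h 1; have h2 := h 2
  rw [pow_zero, mul_one] at h0
  have e1 : ‖(f m : ℂ) * p.W m (Sum.inr (Sum.inr ())) 1‖ / (15 * p.Γ m) ≤ f m := by
    rw [div_le_iff₀ hM]; simpa using h1
  have e2 : ‖(f m : ℂ) * p.W m (Sum.inr (Sum.inr ())) 2‖ / (15 * p.Γ m) ^ 2 ≤ f m := by
    rw [div_le_iff₀ (by positivity)]; exact h2
  linarith

/-- **spill size**: seen from level `m ≥ m'`, the `j'`-th own multiple of level `m'` has weighted size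
`≤ 3 (Σ_g a_g) e^{-L(j'-1)}`. -/
theorem nrm_Φ_le {m' m : ℕ} (hm : m' ≤ m) (a : G → ℝ) (ha : ∀ g, 0 ≤ a g) (j' : ℕ) :
    p.nrm m (p.Φ a m' j') ≤ 3 * (∑ g : G, a g) * Real.exp (-(20 * ((j' : ℝ) - 1))) := by
  have hM : 0 < 15 * p.Γ m := by have := p.Γ_pos m; positivity
  have hΓ' := (p.Γ_pos m').le
  set e := Real.exp (-(20 * ((j' : ℝ) - 1))) with he
  have he0 : 0 ≤ e := (Real.exp_pos _).le
  have h : ∀ r, ‖p.Φ a m' j' r‖ ≤ (∑ g : G, a g) * e * (15 * p.Γ m) ^ r := fun r ↦ by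
    unfold Φ
    refine le_trans (norm_sum_le _ _) ?_
    rw [Finset.sum_mul, Finset.sum_mul]
    refine Finset.sum_le_sum fun g _ ↦ ?_
    rw [norm_mul, norm_mul, norm_mul, Complex.norm_real, Complex.norm_real, Real.norm_of_nonneg (ha g),
      Real.norm_of_nonneg he0, p.norm_φ_pow, mul_one]
    refine mul_le_mul_of_nonneg_left ?_ (mul_nonneg (ha g) he0)
    exact le_trans (p.norm_W_le m' g r) (pow_le_pow_left₀ (by positivity) (by linarith [p.Γ_mono hm]) r)
  simp only [nrm]
  have h0 := h 0; have h1 := h 1; have h2 := h 2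
  rw [pow_zero, mul_one] at h0
  have e1 : ‖p.Φ a m' j' 1‖ / (15 * p.Γ m) ≤ (∑ g : G, a g) * e := by
    rw [div_le_iff₀ hM]; simpa using h1
  have e2 : ‖p.Φ a m' j' 2‖ / (15 * p.Γ m) ^ 2 ≤ (∑ g : G, a g) * e := by
    rw [div_le_iff₀ (by positivity)]; exact h2
  linarith

/-- the raw level bound: `E_m ≤ 440742 · nrm(R_m) + 1322259 · f_m`. -/
theorem E_le_raw (m : ℕ) : p.E m ≤ 440742 * p.nrm m (p.R p.amp m) + 1322259 * f m := by
  have h1 : p.E m = ∑ g : G, p.solve m (p.tgt p.amp m) g := by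
    unfold E; rw [p.amp_eq m]
  have h2 := p.sum_solve_le m (p.tgt p.amp m)
  have h3 := p.SR_add_SI_le m (p.tgt p.amp m)
  have h4 : p.nrm m (p.tgt p.amp m) ≤ p.nrm m (p.R p.amp m) + 3 * f m := by
    have e : p.tgt p.amp m = fun r ↦ -p.R p.amp m r - (f m : ℂ) * p.W m (Sum.inr (Sum.inr ())) r := rfl
    have h5 : p.nrm m (fun r ↦ -p.R p.amp m r - (f m : ℂ) * p.W m (Sum.inr (Sum.inr ())) r) ≤
        p.nrm m (p.R p.amp m) + p.nrm m (fun r ↦ (f m : ℂ) * p.W m (Sum.inr (Sum.inr ())) r) :=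
      p.nrm_neg_sub m (p.R p.amp m) (fun r ↦ (f m : ℂ) * p.W m (Sum.inr (Sum.inr ())) r)
    have h6 := p.nrm_forcing_le m
    rw [e]
    linarith
  rw [h1]
  nlinarith

/-- membership in the visible set `D m`. -/
theorem mem_D {m m' : ℕ} (h : m' ∈ D m) : m' < m ∧ (m' + 1) ∣ (m + 1) := by
  simpa [D] using h

/-- visible earlier levels have quotient `≥ 2`. -/
theorem two_le_quot {m m' : ℕ} (h : m' ∈ D m) : 2 ≤ (m + 1) / (m' + 1) := by
  obtain ⟨hlt, hd⟩ := mem_D h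
  obtain ⟨q, hq⟩ := hd
  rw [hq, Nat.mul_div_cancel_left _ (Nat.succ_pos m')]
  by_contra hc
  push Not at hc
  interval_cases q
  · simp at hq
  · simp at hq; omega

/-- `f_{m'} = j⁴ f_m` for a visible earlier level with quotient `j`. -/
theorem f_of_mem_D {m m' : ℕ} (h : m' ∈ D m) : f m' = (((m + 1) / (m' + 1) : ℕ) : ℝ) ^ 4 * f m := by
  obtain ⟨_, hd⟩ := mem_D h
  obtain ⟨q, hq⟩ := hd
  rw [hq, Nat.mul_div_cancel_left _ (Nat.succ_pos m')]
  have e : ((m : ℝ) + 1) = ((m' : ℝ) + 1) * q := by exact_mod_cast hq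
  unfold f
  rw [e]
  have : (0 : ℝ) < (m' : ℝ) + 1 := by positivity
  have hq0 : (0 : ℝ) < q := by
    have : 0 < q := by
      rcases Nat.eq_zero_or_pos q with rfl | hq' 
      · simp at hq
      · exact hq'
    exact_mod_cast this
  field_simp

/-- reindex the visible earlier levels by their quotient `j = (m+1)/(m'+1) ∈ [2, m+1]`. -/
theorem sum_D_le (m : ℕ) (t : ℕ → ℝ) (ht : ∀ j, 0 ≤ t j) :
    ∑ m' ∈ D m, t ((m + 1) / (m' + 1)) ≤ ∑ j ∈ Finset.Ico 2 (m + 2), t j := by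
  have hinj : Set.InjOn (fun m' ↦ (m + 1) / (m' + 1)) (D m : Set ℕ) := by
    intro m₁ h₁ m₂ h₂ he
    obtain ⟨_, d₁⟩ := mem_D (Finset.mem_coe.mp h₁)
    obtain ⟨_, d₂⟩ := mem_D (Finset.mem_coe.mp h₂)
    have e₁ := Nat.div_mul_cancel d₁
    have e₂ := Nat.div_mul_cancel d₂
    simp only at he
    rw [he] at e₁
    have hpos : 0 < (m + 1) / (m₂ + 1) := Nat.div_pos (Nat.le_of_dvd (Nat.succ_pos m) d₂) (Nat.succ_pos m₂)
    have := e₁.trans e₂.symm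
    have := Nat.eq_of_mul_eq_mul_left hpos this
    omega
  rw [← Finset.sum_image hinj]
  refine Finset.sum_le_sum_of_subset_of_nonneg ?_ fun j _ _ ↦ ht j
  intro j hj
  rw [Finset.mem_image] at hj
  obtain ⟨m', hm', rfl⟩ := hj
  rw [Finset.mem_Ico]
  refine ⟨two_le_quot hm', ?_⟩
  have := Nat.div_le_self (m + 1) (m' + 1)
  omega

/-- `e^{-20} ≤ 10^{-8}`. -/
theorem exp_neg_twenty_le : Real.exp (-20) ≤ 1 / 10 ^ 8 := by
  have h1 := Real.exp_one_gt_d9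
  have h20 : (2.7182818283 : ℝ) ^ 20 ≤ (Real.exp 1) ^ 20 := pow_le_pow_left₀ (by norm_num) h1.le 20
  have h3 : (10 : ℝ) ^ 8 ≤ 2.7182818283 ^ 20 := by norm_num
  rw [Real.exp_neg, show (20 : ℝ) = ((20 : ℕ) : ℝ) by norm_num, ← Real.exp_one_pow 20]
  rw [inv_eq_one_div]
  exact one_div_le_one_div_of_le (by norm_num) (h3.trans h20)

/-- the spill profile `j⁴ e^{-20(j-1)}` at `j = i + 2` is at most `16 e^{-20} (e^{-18})^i`. -/
theorem profile_le (i : ℕ) :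
    ((i + 2 : ℕ) : ℝ) ^ 4 * Real.exp (-(20 * ((((i + 2 : ℕ)) : ℝ) - 1))) ≤
      16 * Real.exp (-20) * Real.exp (-18) ^ i := by
  have hu : ((i + 2 : ℕ) : ℝ) = (i : ℝ) + 2 := by push_cast; ring
  rw [hu]
  have h1 : ((i : ℝ) + 2) ^ 4 ≤ 16 * Real.exp ((i : ℝ) / 2) ^ 4 := by
    have h := Real.add_one_le_exp ((i : ℝ) / 2)
    have h0 : (0 : ℝ) ≤ (i : ℝ) / 2 + 1 := by positivity
    have := pow_le_pow_left₀ h0 h 4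
    nlinarith
  have h2 : Real.exp ((i : ℝ) / 2) ^ 4 = Real.exp (2 * (i : ℝ)) := by
    rw [← Real.exp_nat_mul]; congr 1; push_cast; ring
  have h3 : Real.exp (-(20 * ((i : ℝ) + 2 - 1))) = Real.exp (-20) * Real.exp (-20 * (i : ℝ)) := by
    rw [← Real.exp_add]; congr 1; ring
  have h4 : Real.exp (-18) ^ i = Real.exp (-18 * (i : ℝ)) := by
    rw [← Real.exp_nat_mul]; congr 1; ring
  rw [h3, h4]
  have h5 : Real.exp (2 * (i : ℝ)) * Real.exp (-20 * (i : ℝ)) = Real.exp (-18 * (i : ℝ)) := by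
    rw [← Real.exp_add]; congr 1; ring
  have := Real.exp_pos (-20); have := Real.exp_pos (-20 * (i : ℝ))
  calc ((i : ℝ) + 2) ^ 4 * (Real.exp (-20) * Real.exp (-20 * (i : ℝ)))
      ≤ 16 * Real.exp ((i : ℝ) / 2) ^ 4 * (Real.exp (-20) * Real.exp (-20 * (i : ℝ))) := by gcongr
    _ = 16 * Real.exp (-20) * (Real.exp (2 * (i : ℝ)) * Real.exp (-20 * (i : ℝ))) := by rw [h2]; ring
    _ = 16 * Real.exp (-20) * Real.exp (-18 * (i : ℝ)) := by rw [h5]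

/-- the total spill profile over all quotients: `Σ_{j ∈ [2, m+1]} j⁴ e^{-20(j-1)} ≤ 17 e^{-20}`. -/
theorem profile_sum_le (m : ℕ) :
    ∑ j ∈ Finset.Ico 2 (m + 2), (j : ℝ) ^ 4 * Real.exp (-(20 * ((j : ℝ) - 1))) ≤ 17 * Real.exp (-20) := by
  rw [Finset.sum_Ico_eq_sum_range, show m + 2 - 2 = m from rfl]
  have hx0 : 0 ≤ Real.exp (-18) := (Real.exp_pos _).le
  have hx1 : Real.exp (-18) ≤ 1 / 17 := by
    have h := Real.add_one_le_exp (18 : ℝ)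
    rw [Real.exp_neg, inv_eq_one_div]
    exact div_le_div_of_nonneg_left (by norm_num) (by norm_num) (by linarith)
  have hgeom : ∑ i ∈ Finset.range m, Real.exp (-18) ^ i ≤ 17 / 16 := by
    have h := geom_sum_mul_neg (Real.exp (-18)) m
    have hpow : 0 ≤ Real.exp (-18) ^ m := pow_nonneg hx0 m
    have h1x : 0 < 1 - Real.exp (-18) := by linarith
    have : (∑ i ∈ Finset.range m, Real.exp (-18) ^ i) * (1 - Real.exp (-18)) ≤ 1 := by rw [h]; linarith
    have hs : ∑ i ∈ Finset.range m, Real.exp (-18) ^ i ≤ 1 / (1 - Real.exp (-18)) := by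
      rw [le_div_iff₀ h1x]; exact this
    refine hs.trans ?_
    rw [div_le_div_iff₀ h1x (by norm_num)]
    linarith
  have he := Real.exp_pos (-20)
  calc ∑ i ∈ Finset.range m, (((2 + i : ℕ)) : ℝ) ^ 4 * Real.exp (-(20 * ((((2 + i : ℕ)) : ℝ) - 1)))
      ≤ ∑ i ∈ Finset.range m, 16 * Real.exp (-20) * Real.exp (-18) ^ i :=
        Finset.sum_le_sum fun i _ ↦ by rw [add_comm 2 i]; exact profile_le i
    _ = 16 * Real.exp (-20) * ∑ i ∈ Finset.range m, Real.exp (-18) ^ i := by rw [Finset.mul_sum]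
    _ ≤ 16 * Real.exp (-20) * (17 / 16) := by gcongr
    _ = 17 * Real.exp (-20) := by ring

/-- **the budget**: `E_m ≤ 2·10⁶ f_m` for every level. -/
theorem E_le (m : ℕ) : p.E m ≤ 2000000 * f m := by
  induction m using Nat.strong_induction_on with
  | _ m ih =>
  have hf := f_pos m
  have hraw := p.E_le_raw m
  -- the residual
  have hR : p.nrm m (p.R p.amp m) ≤ 3 * 2000000 * f m * (17 * Real.exp (-20)) := by
    have h1 : p.nrm m (p.R p.amp m) ≤ ∑ m' ∈ D m, p.nrm m (p.Φ (p.amp m') m' ((m + 1) / (m' + 1))) :=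
      p.nrm_sum_le m (D m) _
    have h2 : ∀ m' ∈ D m, p.nrm m (p.Φ (p.amp m') m' ((m + 1) / (m' + 1))) ≤
        3 * 2000000 * f m * ((((m + 1) / (m' + 1) : ℕ) : ℝ) ^ 4 *
          Real.exp (-(20 * (((((m + 1) / (m' + 1) : ℕ)) : ℝ) - 1)))) := by
      intro m' hm'
      obtain ⟨hlt, _⟩ := mem_D hm'
      have h3 := p.nrm_Φ_le hlt.le (p.amp m') (fun g ↦ (p.amp_pos m' g).le) ((m + 1) / (m' + 1))
      have h4 : ∑ g : G, p.amp m' g ≤ 2000000 * f m' := ih m' hlt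
      rw [f_of_mem_D hm'] at h4
      have he := (Real.exp_pos (-(20 * (((((m + 1) / (m' + 1) : ℕ)) : ℝ) - 1)))).le
      have hE := p.E_nonneg m'
      unfold E at hE
      nlinarith [mul_le_mul_of_nonneg_right h4 he]
    have h5 := Finset.sum_le_sum h2
    rw [← Finset.mul_sum] at h5
    have h6 := sum_D_le m (fun j ↦ (j : ℝ) ^ 4 * Real.exp (-(20 * ((j : ℝ) - 1)))) (fun j ↦ by positivity)
    have h7 := profile_sum_le m
    have h8 : 0 ≤ 3 * 2000000 * f m := by positivity
    calc p.nrm m (p.R p.amp m) ≤ _ := h1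
      _ ≤ _ := h5
      _ ≤ 3 * 2000000 * f m * (17 * Real.exp (-20)) := by
          exact mul_le_mul_of_nonneg_left (h6.trans h7) h8
  have h20 := exp_neg_twenty_le
  nlinarith

end Prm

end Summit.RiemannHypothesis.RiemannHypothesis.Theorems.TwoPrimeFoldRigidity.Negative.MBT
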